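import Mathlib
import HarnessLib
import HarnessLib.Audit
import Summits.MatrixMultiplication.Statement
import Literature.Computability.AlgebraicComplexity.DivisionSLP
import Literature.Computability.AlgebraicComplexity.FlatteningBound
import Summits.MatrixMultiplication.MatrixMultiplication.Theorems.CondensationDistanceDerivationsBoundOmega
import HarnessLib.Audit.Status.Attr

/-!
Route: LinearSolveSplit

# Route LinearSolveSplit — omega=2 iff one generic linear system is solvable in quadratic time and
the determinant is no harder than one solve

It suffices to show X = SlsQuadratic ∧ DetReducesToSls, and S ⟺ X (lens draft `summit_iff_split`,
modulo the two PROVED tree theorems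
`detAdmissible_of_omega_lt` / `slsExponent_le_omega` whose modules have no hub build today, carried
as hypothesis-defs `DetUpper` /
`SlsUpper`). The node is Strassen's Problem 16.1 («ω(SLS) = ω? Decide whether these exponents are
equal!», BCS 1997 p.483) cut into its two
halves and hung under the ONE certified translation ω(ℂ) = 2 ⟺ ω(Det) ≤ 2 (E; the direction E ⟹ S is
the tree theorem
`DerivationsBoundOmega_of`: Strassen 1973 pairs → Andrews 2022 → Bini). SlsQuadratic (A, the
ALGORITHMIC half): ONE generic nonsingular
n × n linear system is solvable by straight-line programs with division of length n^(2+o(1)).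
DetReducesToSls (B, the HARDNESS half, the
part we can attack now through its ladder): every exponent admissible for one linear solve is
admissible for the generic determinant —
ω(Det) ≤ max(2, ω(SLS)) — a statement between two problem sequences that mentions neither ω nor S.
Decomposition-workshop node (decomp-mm
gen 0, lens 3 «one certified translation + split beneath»); no idea card realised; census v1 rows R6
(the Det-EQUIV alone is COSTUME) and
W10 (preview of this node) are its only prior record.
Lean: `(∀ τ : ℝ, 2 < τ → ∃ C : ℝ, ∃ n₀ : ℕ, ∀ n ≥ n₀, ∃ s : ℕ, (s : ℝ) ≤ C * (n : ℝ) ^ τ ∧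
Literature.Computability.AlgebraicComplexity.Derivable ℂ s (Set.range fun p : Fin n × Fin (n + 1) =>
algebraMap (MvPolynomial (Fin n × Fin (n + 1)) ℂ) (FractionRing (MvPolynomial (Fin n × Fin (n + 1))
ℂ)) (MvPolynomial.X p)) (Set.range (Matrix.mulVec (Matrix.of fun i j : Fin n => algebraMap
(MvPolynomial (Fin n × Fin (n + 1)) ℂ) (FractionRing (MvPolynomial (Fin n × Fin (n + 1)) ℂ))
(MvPolynomial.X (i, Fin.castSucc j)))⁻¹ fun i : Fin n => algebraMap (MvPolynomial (Fin n × Fin (n +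
1)) ℂ) (FractionRing (MvPolynomial (Fin n × Fin (n + 1)) ℂ)) (MvPolynomial.X (i, Fin.last n))))) ∧
(∀ τ : ℝ, 2 ≤ τ → (∃ C : ℝ, ∃ n₀ : ℕ, ∀ n ≥ n₀, ∃ s : ℕ, (s : ℝ) ≤ C * (n : ℝ) ^ τ ∧
Literature.Computability.AlgebraicComplexity.Derivable ℂ s (Set.range fun p : Fin n × Fin (n + 1) =>
algebraMap (MvPolynomial (Fin n × Fin (n + 1)) ℂ) (FractionRing (MvPolynomial (Fin n × Fin (n + 1))
ℂ)) (MvPolynomial.X p)) (Set.range (Matrix.mulVec (Matrix.of fun i j : Fin n => algebraMap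
(MvPolynomial (Fin n × Fin (n + 1)) ℂ) (FractionRing (MvPolynomial (Fin n × Fin (n + 1)) ℂ))
(MvPolynomial.X (i, Fin.castSucc j)))⁻¹ fun i : Fin n => algebraMap (MvPolynomial (Fin n × Fin (n +
1)) ℂ) (FractionRing (MvPolynomial (Fin n × Fin (n + 1)) ℂ)) (MvPolynomial.X (i, Fin.last n))))) → ∀
τ' : ℝ, τ < τ' → ∃ C : ℝ, ∃ n₀ : ℕ, ∀ n ≥ n₀, ∃ (m' : ℕ) (h : n ≤ m') (s : ℕ), (s : ℝ) ≤ C * (n : ℝ)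
^ τ' ∧ Literature.Computability.AlgebraicComplexity.Derivable ℂ s (Set.range fun p : Fin n × Fin m'
=> algebraMap (MvPolynomial (Fin n × Fin m') ℂ) (FractionRing (MvPolynomial (Fin n × Fin m') ℂ))
(MvPolynomial.X p)) {algebraMap (MvPolynomial (Fin n × Fin m') ℂ) (FractionRing (MvPolynomial (Fin n
× Fin m') ℂ)) (Matrix.det (Matrix.of fun i j : Fin n => MvPolynomial.X (i, Fin.castLE h j)))})`

## Assembly
`closes (hA : SlsQuadratic) (hB : DetReducesToSls) : _root_.MatrixMultiplication` (glue.lean, 8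
lines): ω ≥ 2 is the kernel floor
`omega_two_le ℂ`; for ω ≤ 2 it suffices by density that ω ≤ c for every c > 2: put τ = (2+c)/2, get
SLS-admissibility at τ from hA,
Det-admissibility at c from hB, and ω ≤ c from the tree theorem `DerivationsBoundOmega_of` (BCS Thm
(16.7) second half: Strassen 1973
degree-2 components → Andrews 2022 Thm 3 → Bini) unfolded at c. Both cruxes are consumed (bc6:
declared 3 / in-cone 2 / Assembly exempt);
exactness S ⟺ A ∧ B is the lens draft's `summit_iff_split`
(HOME/decomp-mm-lens-3/LinearSolveSplit.lean, kernel modulo DetUpper/SlsUpper).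

Rationale: WHY THIS LINE. Every one of the 80 matrix-multiplication theses and every other workshop node (N1
tightness of rectangular exponents, N2/N5 finite
saturation on tall shapes, N6 the n^(4/3) asymptotic-rank law) lives on the tensor / shape /
asymptotic-spectrum axes; none uses the
exponents of the classical PROBLEMS of computational linear algebra (BurgisserClausenShokrollahi1997
Ch. 16: Det, Inv, LUP, charpoly,
SLS), although BCS Thm (16.7) makes ω(Det) = ω a theorem and Problem 16.1 (ω(SLS) = ω?) has been
open since Strassen1969 / 1990. The
import is from algebraic complexity theory proper — straight-line programs with division on generic
inputs (tree `Derivable`, BCS (4.7)),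
Strassen1973 Vermeidung von Divisionen, BaurStrassen1983 derivatives, Andrews2022 (division
elimination for the determinant, used by the
tree theorem `DerivationsBoundOmega_of`) — not from tensor geometry: the split is by an INTERMEDIATE
PROBLEM on the hardness axis
(matrix × vector ≤ SLS ≤ Det ≡ MaMu), and SLS is the only classical point of that axis at which both
halves are open (kernel dial in the
lens draft: at Π = Det piece A is the costume E and B a theorem; at Π quadratic A is a theorem and B
the costume). What it does that no
route does: it makes «matrix multiplication reduces to ONE linear solve» (B; rank-language twin
`MatMulReducesToSls`, necessary with no
hypothesis at all) a typed, necessary, strictly-weaker target with a ladder whose first rung (det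
from n solves, Schur telescoping) is a
theorem in print and whose open rungs («det from o(n) single-right-hand-side solves») nobody has
attacked in the algebraic model
(sub-n^ω solvers exist only in bit models: Peng–Vempala doi:10.1137/1.9781611976465.31).

RANKED CRUXES. #2 SlsQuadratic (crux) — Piece A, «ω(SLS) ≤ 2»: for every τ > 2 there are C, n₀ such
that for all n ≥ n₀ the n coordinates of X⁻¹b — X, b the generic n × n matrix and vector, i.e. the
generic n × (n+1) matrix [X | b] over ℂ — are derivable from the entries of [X | b] by a
straight-line program with division of length ≤ C·n^τ. Tag WEAKER (S ⟹ A: BCS Prop (16.6) ω(SLS) ≤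
ω, tree theorem `slsExponent_le_omega` = lens `slsQuadratic_of_summit (hS : SlsUpper)`; A ⟹ S open =
the affirmative half of Problem 16.1); leaf IDEA-NEEDED + INSTRUMENTABLE (census test T_A: best
algebraic-model exponent for ONE dense system strictly below the ω record — expected none).
[difficulty: open-problem] (why it might fail: false iff ω(SLS) > 2, which forces ω > 2 (BCS 16.6) —
it cannot fail without the summit failing; the risk is hardness: no algebraic single-system solver
below elimination (n^ω) is known, sub-n^ω solvers (Peng–Vempala 2021) are bit-model only.)
[BurgisserClausenShokrollahi1997, Strassen1969, doi:10.1137/1.9781611976465.31, doi:10.1145/3767721]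
#3 DetReducesToSls (crux) — Piece B, «ω(Det) ≤ max(2, ω(SLS))»: for every τ ≥ 2, if τ is admissible
for ONE generic linear solve (as in SlsQuadratic at τ) then every τ' > τ is admissible for the
determinant of the generic n × n matrix (auxiliary columns allowed — verbatim the hypothesis of
`CondensationDistance.DerivationsBoundOmega` at τ'). Tag WEAKER (S ⟹ B: BCS Thm (16.7) ω(Det) ≤ ω =
2, tree theorem `detAdmissible_of_omega_lt` = lens `detReducesToSls_of_summit (hU : DetUpper)`; the
rank-language twin «∀ τ ≥ 2, SLS admissible at τ → ω ≤ τ» is necessary with NO hypothesis, lens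
`matMulReducesToSls_of_summit`; B ⟹ S open: B follows from the «equal» answer ω(Det) = ω(SLS) to
Problem 16.1, consistent with ω > 2); NOT the residual A → S (it implies it, lens
`residual_of_detReducesToSls`, and has content when A fails); leaf ATTACKABLE through the ladder
DetLeSlsPlus μ («det costs n^μ single solves in exponent»; rung 0 = B, rung 1 = theorem in print,
rungs 0 < μ < 1 open) and the kernel-glued gen-1 split B ⇐ DetLeSlsPlusOne + SolveCountHalving (lens
`detReducesToSls_of_halving`). [difficulty: open-problem] (why it might fail: false iff ω(SLS) <
ω(Det) (a genuine separation of one linear solve from det/matrix multiplication, e.g. ω(SLS) = 2 <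
ω); typed obstructions to proving it: SLS is closed under the Baur–Strassen adjoint (two solves + a
rank-one product, never det), and a solve-oracle needs n adaptive queries for det.)
[BurgisserClausenShokrollahi1997, BaurStrassen1983, Strassen1973, Andrews2022, Kalorkoti1985]

TWO-LAYER PLAN. DetReducesToSls ⇐ DetLeSlsPlusOne → SolveCountHalving → DetReducesToSls (gen-1
split, glue PROVED in the lens draft as
`detReducesToSls_of_halving`, exact modulo rung 1 `detReducesToSls_iff_halving`): DetLeSlsPlusOne
(support, provable now: «ω(Det) ≤
ω(SLS) + 1», Schur-complement telescoping det X = ∏ (x_kk − r_kᵀ X_[k−1]⁻¹ c_k), one generic solve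
of size k − 1 per pivot on independent
data + O(n²); kernel needs `Derivable` transport along injective field maps, ~400 lines; one-line
Prop ready in
HOME/decomp-mm-lens-3/pieces-inlined.lean) and SolveCountHalving (crux child: for 0 < μ ≤ 1,
DetLeSlsPlus μ → DetLeSlsPlus (μ/2) — the
self-improvement form in which ω(Det) = ω(SLS) would most plausibly be proved; necessary,
IDEA-NEEDED). To be filed by `route edit --split`
right after birth so that provers have the finite handle (critic w4 pattern on RootDecomp1).
SlsQuadratic is not split (IDEA-NEEDED); its
natural layer-2 children are the batched problems SLS^(n^δ) (stronger in δ) once an idea exists.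

KILL CRITERIA. A refutation of SlsQuadratic (ω(SLS) > 2 as a theorem) refutes the SUMMIT itself (BCS
16.6), so it closes everything; a refutation of
DetReducesToSls (a theorem ω(SLS) < ω(Det), i.e. one linear solve is strictly easier than matrix
multiplication in exponent) closes the
route `refuted:DetReducesToSls`, answers Problem 16.1 in the negative and — if the separating solver
is quadratic — leaves exactly the
residual; a proof of ω = 2 by any other route moots both pieces (each is necessary). A kernel proof
that `SlsAdmissibleAt τ` fails for
τ < 2 (input-reading bound) changes nothing (the pieces quantify over τ ≥ 2 / τ > 2 only).

NOT DECOMPOSED YET. SlsQuadratic is deliberately not decomposed (no mechanism for a sub-elimination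
algebraic single-system solver is known; bit-model
solvers do not transfer). The rungs 0 < μ < 1 of the ladder other than the dyadic ones produced by
SolveCountHalving, the batched dial
points SLS^(n^δ) (second ladder B_δ «loss < 1 − δ»), the Tr(X⁻¹)/LUP/Inv dial points (COSTUME or not
kernel-certifiable in the
generic-SLP model: input specialisation X = [[A,0],[0,B]] is not a K-algebra map into the generic
fraction field), and the discharge of the
hypothesis-defs DetUpper / SlsUpper by the tree theorems (once modules DeterminantExponent /
LinearSystemExponentProofs build on the hub)
are layer-2 / support work.

CHEAPEST FALSIFIER. A literature lookup (census tests T_A / T_B, < 2 core-h, no compute): is there,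
in ANY algebraic model (SLP with division, arithmetic
circuits over ℂ), (T_A) a solver for one dense generic n × n system with exponent strictly below the
current ω bound, or (T_B) an
algorithm computing det from n^μ single-right-hand-side solves plus quadratic work with μ < 1 (or
with loss < 1 − δ from n^δ right-hand
sides)? Either hit re-prices a piece (T_A hit: A becomes record-paying; T_B hit: a rung below 1 is a
theorem and the ladder moves); the
lens's own searches (corpus fts+vec, galaxy, OpenAlex) found none — sub-n^ω solvers exist only in
bit complexity (Peng–Vempala 2021,
Dereziński–Musco–Yang 2024/25), block-Krylov/Wiedemann methods count matrix × vector products, not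
solves.

NUMBERS. ω ≤ 2.37295 in kernel (`LeGall2014_cw4_omega_le`; print 2.371339); ω(Det) = ω(LUP) = ω(Inv)
= ω (BCS Thm 16.7; tree DeterminantExponent /
LupDecompositionExponent, unbuilt on the hub); ω(SLS) ≤ ω (BCS Prop 16.6) and ≥ 2 trivially untyped;
ladder: rung μ = 1 theorem (n solves of
sizes 1..n−1: Σ k^τ ≤ n^(τ+1)), rung 0 = B, no μ < 1 in print; batched dial: n^δ right-hand sides
give loss 1 − δ by the same telescoping;
Kalorkoti (BCS Ex 16.7 p.480): C(MaMu_n) ≤ 828·L(Tr(A⁻¹)_3n) + O(n²) — ONE scalar is already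
MaMu-hard, so the n scalars of X⁻¹b are the
first open point; bit-model single-system solvers: Peng–Vempala Õ(n^2.331645) for poly-conditioned
sparse systems (bit operations, not
an algebraic exponent).

DEFINITION REQUESTS. None filed: the pieces are inlined over
`Literature.Computability.AlgebraicComplexity.Derivable` (DivisionSLP) and Mathlib
(`FractionRing (MvPolynomial (Fin n × Fin m) ℂ)`, `Matrix.mulVec`, `Matrix.det`); a support
definitions module
(`Theorems/SlpExponents.lean`: DetAdmissibleAt, DetExpLe, genEntry, sysMatrix/sysRhs/sysSolution,
SlsAdmissibleAt, DetLeSlsPlus + the kernel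
lemmas of the lens draft) would shorten every item to one short line and is offered to the writer
(HOME/decomp-mm-lens-3/).

Novelty: Searches (2026-08-30): rg over the 80 Theses/*.lean + negatives (12) + TREE.md/COSTUME-CENSUS-v1 for
"slsExponent|SlsAdmissible|LinearSystem|Problem 16.1|X⁻¹ ?b" (0 route items; census R6/W10 only);
lit search --hybrid "exponent of solving a linear system equals exponent of matrix multiplication
Strassen problem" (corpus: burgisser1997 pp.460,462,480,483,485); lit vsearch "is solving one system
of linear equations as hard as matrix multiplication in the algebraic model" (BCS 1997 Ch.16; Raz
2003; no converse); lit search "linear system" "matrix multiplication" exponent reduction --source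
all (OpenAlex/S2: Peng–Vempala 2021 doi:10.1137/1.9781611976465.31, faster sparse solvers
doi:10.1145/3767721 — bit model); lit galaxy search "Vermeidung von Divisionen|solving linear
systems|SLS" --star all (galaxy:pdf:8005674229943449720 = arXiv:2109.12736 PIT/derivatives,
galaxy:pdf:-1373148646528748120; no reduction det ≤ SLS); lit citing doi:10.1007/bf01272518 /
doi:10.1137/1.9781611975994.17 (graph: no paper on Problem 16.1's hardness half).
Nearest prior art found: BurgisserClausenShokrollahi1997 §16.5–16.6 (Prop 16.6 ω(SLS) ≤ ω, Thm 16.7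
ω(Det) = ω, Problem 16.1, Ex 16.7 Kalorkoti Tr(A⁻¹)); Andrews2022 Thm 3 (det with divisions → ω, the
E ⟹ S engine, tree theorem); Peng–Vempala 2021 (bit-model sub-n^ω single-system solver, explicitly
not algebraic); census W10 (this node's preview).
Delta: Problem 16.1 is typed for the first time as an exact two-piece decomposition of ω = 2 — its
algo  [refs: 10.1137/1.9781611976465.31, 10.1145/3767721, 10.1007/bf01272518, 10.1137/1.9781611975994.17, 2109.12736, doi:10.1137/1.9781611976465.31, doi:10.1145/3767721, doi:10.1007/bf01272518, doi:10.1137/1.9781611975994.17, BurgisserClausenShokrollahi1997, Andrews2022]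

Barriers (technique_class: algebraic-complexity, reduction, straight-line-program): - technique_class: algebraic-complexity, reduction, straight-line-program
- Literature.Barriers.MatrixMultiplication.UniversalMethodBarrier: outside — no bound on ω is
certified through powers or degenerations of a fixed tensor; A is an algorithm for a non-bilinear
problem (X⁻¹b is rational of degree −1..n in X), B a reduction between problems; the barrier
quantifies over neither.
- Literature.Barriers.MatrixMultiplication.IrreversibilityBarrier: outside for the same reason (no
intermediate tensor; the «intermediate» here is a PROBLEM sequence, and reductions between problems
(BCS (16.7), Baur–Strassen) are not tensor restrictions/degenerations).
- Literature.Barriers.MatrixMultiplication.UnstableTensorBarrier: does not apply (no tensor occurs).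
- Literature.Barriers.MatrixMultiplication.RectangularBarrier: does not apply (no rectangular
exponent occurs; the batched dial SLS^(n^δ) would touch ω(1,1,δ) only through the known batching
upper bound, never as a certificate).
- Literature.Barriers.MatrixMultiplication.TricoloredSumFreeBarrier: does not apply (no group / STPP
design).
- Literature.Barriers.MatrixMultiplication.LinearRankMethodBarrier: refutation-side only — refuting
B needs a LOWER bound separating det from one solve, i.e. a super-quadratic lower bound for
det-with-divisions relative to an SLS upper bound; every known lower-bound method for det/MaMu SLPs
is linear/rank-type and stops at Ω(n²) (so B is not cheaply killable either; acknowledged). Refuting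
A likewise n

History (route lifecycle, newest last):
- 2026-08-30T02:13:03Z · rev 2: dropped SolveCountHalving, DetLeSlsPlusOne, DetReducesToSlsGlue — retract gen-1 split of DetReducesToSls (critic C1, CLEARED 01:52:57Z): rung 1 DetLeSlsPlusOne is trivial modulo the backlog theorem DetUpper (τ+1 ≥ 3 ≥ ω), henc (planner-decomp-mm-lens-3-g0-0)
- 2026-08-30T02:14:10Z · rev 2: dropped SolveCountHalving, DetLeSlsPlusOne, DetReducesToSlsGlue — retract gen-1 split of DetReducesToSls (critic C1, CLEARED 01:52:57Z): rung 1 DetLeSlsPlusOne is trivial modulo the backlog theorem DetUpper (τ+1 ≥ 3 ≥ ω), henc (planner-decomp-mm-lens-3-g0-0)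
- 2026-08-30T02:15:11Z · rev 2: dropped SolveCountHalving, DetLeSlsPlusOne, DetReducesToSlsGlue — retract gen-1 split of DetReducesToSls (critic C1, CLEARED 01:52:57Z): rung 1 DetLeSlsPlusOne is trivial modulo the backlog theorem DetUpper (τ+1 ≥ 3 ≥ ω), henc (planner-decomp-mm-lens-3-g0-0)
- 2026-08-30T02:17:49Z · rev 2: dropped SolveCountHalving, DetLeSlsPlusOne, DetReducesToSlsGlue — retract gen-1 split of DetReducesToSls (critic C1, CLEARED 01:52:57Z): rung 1 DetLeSlsPlusOne is trivial modulo the backlog theorem DetUpper (τ+1 ≥ 3 ≥ ω), henc (planner-decomp-mm-lens-3-g0-0)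
- 2026-08-30T02:19:19Z · rev 2: dropped SolveCountHalving, DetLeSlsPlusOne, DetReducesToSlsGlue — retract gen-1 split of DetReducesToSls (critic C1, CLEARED 01:52:57Z): rung 1 DetLeSlsPlusOne is trivial modulo the backlog theorem DetUpper (τ+1 ≥ 3 ≥ ω), henc (planner-decomp-mm-lens-3-g0-0)
- 2026-08-30T02:20:50Z · rev 2: dropped SolveCountHalving, DetLeSlsPlusOne, DetReducesToSlsGlue — retract gen-1 split of DetReducesToSls (critic C1, CLEARED 01:52:57Z): rung 1 DetLeSlsPlusOne is trivial modulo the backlog theorem DetUpper (τ+1 ≥ 3 ≥ ω), henc (planner-decomp-mm-lens-3-g0-0)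

sub-problem: MatrixMultiplication · status: draft · opened planner-decomp-mm-lens-3-g0-0 2026-08-30T02:05:15Z · rev 4 · ledger route-MatrixMultiplication-LinearSolveSplit
GENERATED by the gate from the ledger (D-0016/17). Provers cite these decls: `theorem foo : Summit.MatrixMultiplication.MatrixMultiplication.Theses.LinearSolveSplit.<Decl> := …` in Summits/MatrixMultiplication/MatrixMultiplication/Theorems/<Name>.lean.
-/

namespace Summit.MatrixMultiplication.MatrixMultiplication.Theses.LinearSolveSplit

open scoped BigOperators Topology Manifold Classical MeasureTheory ProbabilityTheory Matrix InnerProductSpace ComplexConjugate ContinuousMap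
open Filter Set Function TopologicalSpace MeasureTheory

attribute [summit_statement] _root_.MatrixMultiplication

/-- item stmt-MatrixMultiplication-24811 · crux · rank 2 · open · by planner
why it might fail: false iff ω(SLS) > 2, which forces ω > 2 (BCS 16.6) — it cannot fail without the summit failing; the risk is hardness: no algebraic single-system solver below elimination (n^ω) is known, sub-n^ω solvers (Peng–Vempala 2021) are bit-model only.
sources: BurgisserClausenShokrollahi1997, Strassen1969, doi:10.1137/1.9781611976465.31, doi:10.1145/3767721
[crux] Piece A, «ω(SLS) ≤ 2»: for every τ > 2 there are C, n₀ such that for all n ≥ n₀ the n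
coordinates of X⁻¹b — X, b the generic n × n matrix and vector, i.e. the generic n × (n+1) matrix [X
| b] over ℂ — are derivable from the entries of [X | b] by a straight-line program with division of
length ≤ C·n^τ. Tag WEAKER (S ⟹ A: BCS Prop (16.6) ω(SLS) ≤ ω, tree theorem `slsExponent_le_omega` =
lens `slsQuadratic_of_summit (hS : SlsUpper)`; A ⟹ S open = the affirmative half of Problem 16.1);
leaf IDEA-NEEDED + INSTRUMENTABLE (census test T_A: best algebraic-model exponent for ONE dense
system strictly below the ω record — expected none). [difficulty: open-problem] -/
@[route_item "route-MatrixMultiplication-LinearSolveSplit", crux]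
def SlsQuadratic : Prop :=
  ∀ τ : ℝ, 2 < τ → ∃ C : ℝ, ∃ n₀ : ℕ, ∀ n ≥ n₀, ∃ s : ℕ, (s : ℝ) ≤ C * (n : ℝ) ^ τ ∧ Literature.Computability.AlgebraicComplexity.Derivable ℂ s (Set.range fun p : Fin n × Fin (n + 1) => algebraMap (MvPolynomial (Fin n × Fin (n + 1)) ℂ) (FractionRing (MvPolynomial (Fin n × Fin (n + 1)) ℂ)) (MvPolynomial.X p)) (Set.range (Matrix.mulVec (Matrix.of fun i j : Fin n => algebraMap (MvPolynomial (Fin n × Fin (n + 1)) ℂ) (FractionRing (MvPolynomial (Fin n × Fin (n + 1)) ℂ)) (MvPolynomial.X (i, Fin.castSucc j)))⁻¹ fun i : Fin n => algebraMap (MvPolynomial (Fin n × Fin (n + 1)) ℂ) (FractionRing (MvPolynomial (Fin n × Fin (n + 1)) ℂ)) (MvPolynomial.X (i, Fin.last n))))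

/-- item stmt-MatrixMultiplication-24812 · crux · rank 3 · SPLIT (gen 1) into DetLeSlsPlusOne, SolveCountHalving + glue DetReducesToSlsGlue · direct attempts still welcome (low priority) · by planner
why it might fail: false iff ω(SLS) < ω(Det) (a genuine separation of one linear solve from det/matrix multiplication, e.g. ω(SLS) = 2 < ω); typed obstructions to proving it: SLS is closed under the Baur–Strassen adjoint (two solves + a rank-one product, never det), and a solve-oracle needs n adaptive queries for det.
sources: BurgisserClausenShokrollahi1997, BaurStrassen1983, Strassen1973, Andrews2022, Kalorkoti1985
[crux] Piece B, «ω(Det) ≤ max(2, ω(SLS))»: for every τ ≥ 2, if τ is admissible for ONE generic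
linear solve (as in SlsQuadratic at τ) then every τ' > τ is admissible for the determinant of the
generic n × n matrix (auxiliary columns allowed — verbatim the hypothesis of
`CondensationDistance.DerivationsBoundOmega` at τ'). Tag WEAKER (S ⟹ B: BCS Thm (16.7) ω(Det) ≤ ω =
2, tree theorem `detAdmissible_of_omega_lt` = lens `detReducesToSls_of_summit (hU : DetUpper)`; the
rank-language twin «∀ τ ≥ 2, SLS admissible at τ → ω ≤ τ» is necessary with NO hypothesis, lens
`matMulReducesToSls_of_summit`; B ⟹ S open: B follows from the «equal» answer ω(Det) = ω(SLS) to
Problem 16.1, consistent with ω > 2); NOT the residual A → S (it implies it, lens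
`residual_of_detReducesToSls`, and has content when A fails); leaf ATTACKABLE through the ladder
DetLeSlsPlus μ («det costs n^μ single solves in exponent»; rung 0 = B, rung 1 = theorem in print,
rungs 0 < μ < 1 open) and the kernel-glued gen-1 split B ⇐ DetLeSlsPlusOne + SolveCountHalving (lens
`detReducesToSls_of_halving`). [difficulty: open-problem] -/
@[route_item "route-MatrixMultiplication-LinearSolveSplit", crux]
def DetReducesToSls : Prop :=
  ∀ τ : ℝ, 2 ≤ τ → (∃ C : ℝ, ∃ n₀ : ℕ, ∀ n ≥ n₀, ∃ s : ℕ, (s : ℝ) ≤ C * (n : ℝ) ^ τ ∧ Literature.Computability.AlgebraicComplexity.Derivable ℂ s (Set.range fun p : Fin n × Fin (n + 1) => algebraMap (MvPolynomial (Fin n × Fin (n + 1)) ℂ) (FractionRing (MvPolynomial (Fin n × Fin (n + 1)) ℂ)) (MvPolynomial.X p)) (Set.range (Matrix.mulVec (Matrix.of fun i j : Fin n => algebraMap (MvPolynomial (Fin n × Fin (n + 1)) ℂ) (FractionRing (MvPolynomial (Fin n × Fin (n + 1)) ℂ)) (MvPolynomial.X (i, Fin.castSucc j)))⁻¹ fun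 i : Fin n => algebraMap (MvPolynomial (Fin n × Fin (n + 1)) ℂ) (FractionRing (MvPolynomial (Fin n × Fin (n + 1)) ℂ)) (MvPolynomial.X (i, Fin.last n))))) → ∀ τ' : ℝ, τ < τ' → ∃ C : ℝ, ∃ n₀ : ℕ, ∀ n ≥ n₀, ∃ (m' : ℕ) (h : n ≤ m') (s : ℕ), (s : ℝ) ≤ C * (n : ℝ) ^ τ' ∧ Literature.Computability.AlgebraicComplexity.Derivable ℂ s (Set.range fun p : Fin n × Fin m' => algebraMap (MvPolynomial (Fin n × Fin m') ℂ) (FractionRing (MvPolynomial (Fin n × Fin m') ℂ)) (MvPolynomial.X p)) {algebraMap (MvPolynomial (Fin n × Fin m') ℂ) (FractionRing (MvPolynomial (Fin n × Fin m') ℂ)) (Matrix.det (Matrix.of fun i j : Fin n => MvPolynomial.X (i, Fin.castLE h j)))}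

/-- item stmt-MatrixMultiplication-26150 · aside · rank 9 · open · by planner
why it might fail: with ω(SLS) ≤ ω it implies the EQUAL answer to Strassen's Problem 16.1 (open since 1990), so an outright proof is at least that hard; false only if ω > 2 and det needs more than n^{o(1)}·n²-mass of generic solves beside quadratic arithmetic — no lower-bound technique for that exists.
sources: BurgisserClausenShokrollahi1997, Strassen1969, BaurStrassen1983, doi:10.1145/3186893
[aside] B_M (gen 2, refines piece B = DetReducesToSls; banked context, not staffed this cycle): «the
generic n×n determinant is QUADRATIC MODULO A QUADRATIC MASS OF FRESH GENERIC SOLVES» — for every ℓ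
> 2 and a > 2 and every threshold m₀ there are C, n₀ such that for n ≥ n₀ det(X) ∈ ℂ(X) is derivable
(tree `Derivable`, SLPs with division) from the entries of X in ≤ C·n^a counted steps by a program
that may, in rounds, present a GENERIC linear system of size m₀ ≤ N ≤ n — an augmented N×(N+1)
matrix given as the image of the indeterminates under a ℂ-algebra map of fields ℂ(Z_{N×(N+1)}) →ₐ[ℂ]
ℂ(X) (algebraically independent derived elements) — and receive its N solution coordinates for free,
with total MASS Σ N² ≤ C·n^ℓ. Kernel (lens file v4): S ⟹ B_M modulo DetUpperSq (= tree thm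
detAdmissible_of_omega_lt at m'=n) `detQuadraticModSolves_of_summit`; B_M ⟹ B
`detReducesToSls_of_modSolves`; SlsQuadratic → B_M → S `closes_oracle`; S ↔ SlsQuadratic ∧ B_M mod
(DetUpperSq, SlsUpper) `summit_iff_oracle_split`. Ladder DetSolveMass ℓ: ℓ<2 COSTUME (kernel
`summit_of_detSolveMass_lt_two`), 2≤ℓ<3 OPEN (SubcubicSolveMass), ℓ=3 theorem (DetSolveMassThree).
Promotion into the cone = one `route edit -/
@[route_item "route-MatrixMultiplication-LinearSolveSplit"]
def DetQuadraticModSolves : Prop :=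
  ∀ ℓ : ℝ, 2 < ℓ → ∀ a : ℝ, 2 < a → ∀ m₀ : ℕ, ∃ C : ℝ, ∃ n₀ : ℕ, ∀ n ≥ n₀, ∃ s w : ℕ, (s : ℝ) ≤ C * (n : ℝ) ^ a ∧ (w : ℝ) ≤ C * (n : ℝ) ^ ℓ ∧ ∃ (q : ℕ) (N : ℕ → ℕ) (c : ℕ → ℕ) (φ : (i : ℕ) → i < q → (FractionRing (MvPolynomial (Fin (N i) × Fin (N i + 1)) ℂ) →ₐ[ℂ] FractionRing (MvPolynomial (Fin n × Fin n) ℂ))) (A : ℕ → Set (FractionRing (MvPolynomial (Fin n × Fin n) ℂ))), (∀ i < q, m₀ ≤ N i ∧ N i ≤ n) ∧ A 0 = Set.range (fun p : Fin n × Fin n => algebraMap (MvPolynomial (Fin n × Fin n) ℂ) (FractionRing (MvPolynomial (Fin n × Fin n) ℂ)) (MvPolynomial.X p)) ∧ (∀ (i : ℕ) (hi : i < q), ∃ B : Set (FractionRing (MvPolynomial (Fin n × Fin n) ℂ)), Literature.Computability.AlgebraicComplexity.Derivable ℂ (c i) (A i) B ∧ (Set.range fun p : Fin (N i) × Fin (N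 i + 1) => φ i hi (algebraMap (MvPolynomial (Fin (N i) × Fin (N i + 1)) ℂ) (FractionRing (MvPolynomial (Fin (N i) × Fin (N i + 1)) ℂ)) (MvPolynomial.X p))) ⊆ B ∧ A (i + 1) = A i ∪ B ∪ Set.range fun j : Fin (N i) => φ i hi (Matrix.mulVec (Matrix.of fun i' j' : Fin (N i) => algebraMap (MvPolynomial (Fin (N i) × Fin (N i + 1)) ℂ) (FractionRing (MvPolynomial (Fin (N i) × Fin (N i + 1)) ℂ)) (MvPolynomial.X (i', Fin.castSucc j')))⁻¹ (fun i' : Fin (N i) => algebraMap (MvPolynomial (Fin (N i) × Fin (N i + 1)) ℂ) (FractionRing (MvPolynomial (Fin (N i) × Fin (N i + 1)) ℂ)) (MvPolynomial.X (i', Fin.last (N i)))) j)) ∧ (∃ c' : ℕ, Literature.Computability.AlgebraicComplexity.Derivable ℂ c' (A q) {algebraMap (MvPolynomial (Fin n × Fin n) ℂ) (FractionRing (MvPolynomial (Fin n × Fin n) ℂ)) (Matrix.det (Matrix.of fun i j : Fin n => MvPolynomial.X (i, j)))} ∧ (∑ i ∈ Finset.range q, c i) + c' ≤ s) ∧ (∑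 i ∈ Finset.range q, N i ^ 2) ≤ w

/-- item stmt-MatrixMultiplication-26151 · aside · rank 9 · closed · proved by Summit.MatrixMultiplication.MatrixMultiplication.Theorems.LinearSolveSplitDetSolveMassThree.detSolveMassThree_holds (prover) · by planner
why it might fail: mathematically Strassen 1969 p.356 / BCS (16.7)(A) read with a solve oracle; formal risks: the sub-block field embeddings ℂ(Z_{k×(k+1)}) →ₐ ℂ(X) (rename injectivity + IsFractionRing.liftAlgHom bookkeeping) and the O(n²) step count of the telescoping product inside Derivable.
sources: Strassen1969, BurgisserClausenShokrollahi1997, galaxy:panama:445121820622848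
[aside] RUNG ℓ = 3 of the solve-mass ladder under B_M (gen 2; THEOREM IN PRINT ⇒ the ATTACKABLE-NOW
leaf of N3; support-rung, banked until staffed): for every a > 2 and m₀, for large n, det(X) is
derivable from the entries of the generic n×n X in ≤ C·n^a counted steps given free solutions of
fresh generic systems of total mass Σ N² ≤ C·n³ — by Gaussian/Schur telescoping det X = ∏ₖ (x_kk −
r_k · X_{<k}⁻¹ c_k): the queries are the generic sub-systems [X_{<k} | c_k], k = m₀ … n−1
(sub-blocks of X, embedded by IsFractionRing.liftAlgHom ∘ MvPolynomial.rename), the leading m₀×m₀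
block is eliminated directly, side arithmetic O(n²) inner products; mass Σ k² ≤ n³. NOT trivial
modulo DetUpper / the ω-record (those give arithmetic n^{ω+o(1)}, the rung pins a ≤ 2+o(1));
necessary for S (kernel `detSolveMass_of_summit`). Size L formalisation (Matrix.det_fromBlocks /
Schur complement + the sub-block field embedding). -/
@[route_item "route-MatrixMultiplication-LinearSolveSplit"]
def DetSolveMassThree : Prop :=
  ∀ a : ℝ, 2 < a → ∀ m₀ : ℕ, ∃ C : ℝ, ∃ n₀ : ℕ, ∀ n ≥ n₀, ∃ s w : ℕ, (s : ℝ) ≤ C * (n : ℝ) ^ a ∧ (w : ℝ) ≤ C * (n : ℝ) ^ (3 : ℝ) ∧ ∃ (q : ℕ) (N : ℕ → ℕ) (c : ℕ → ℕ) (φ : (i : ℕ) → i < q → (FractionRing (MvPolynomial (Fin (N i) × Fin (N i + 1)) ℂ) →ₐ[ℂ] FractionRing (MvPolynomial (Fin n × Fin n) ℂ))) (A : ℕ → Set (FractionRing (MvPolynomial (Fin n × Fin n) ℂ))), (∀ i < q, m₀ ≤ N i ∧ N i ≤ n) ∧ A 0 = Set.range (fun p : Fin n × Fin n => algebraMap (MvPolynomial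 (Fin n × Fin n) ℂ) (FractionRing (MvPolynomial (Fin n × Fin n) ℂ)) (MvPolynomial.X p)) ∧ (∀ (i : ℕ) (hi : i < q), ∃ B : Set (FractionRing (MvPolynomial (Fin n × Fin n) ℂ)), Literature.Computability.AlgebraicComplexity.Derivable ℂ (c i) (A i) B ∧ (Set.range fun p : Fin (N i) × Fin (N i + 1) => φ i hi (algebraMap (MvPolynomial (Fin (N i) × Fin (N i + 1)) ℂ) (FractionRing (MvPolynomial (Fin (N i) × Fin (N i + 1)) ℂ)) (MvPolynomial.X p))) ⊆ B ∧ A (i + 1) = A i ∪ B ∪ Set.range fun j : Fin (N i) => φ i hi (Matrix.mulVec (Matrix.of fun i' j' : Fin (N i) => algebraMap (MvPolynomial (Fin (N i) × Fin (N i + 1)) ℂ) (FractionRing (MvPolynomial (Fin (N i) × Fin (N i + 1)) ℂ)) (MvPolynomial.X (i', Fin.castSucc j')))⁻¹ (fun i' : Fin (N i) => algebraMap (MvPolynomial (Fin (N i) × Fin (N i + 1)) ℂ) (FractionRing (MvPolynomial (Fin (N i) × Fin (N i + 1)) ℂ)) (MvPolynomial.X (i', Fin.last (N i)))) j)) ∧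 (∃ c' : ℕ, Literature.Computability.AlgebraicComplexity.Derivable ℂ c' (A q) {algebraMap (MvPolynomial (Fin n × Fin n) ℂ) (FractionRing (MvPolynomial (Fin n × Fin n) ℂ)) (Matrix.det (Matrix.of fun i j : Fin n => MvPolynomial.X (i, j)))} ∧ (∑ i ∈ Finset.range q, c i) + c' ≤ s) ∧ (∑ i ∈ Finset.range q, N i ^ 2) ≤ w

-- `DetSolveMassThree` holds: proved by `Summit.MatrixMultiplication.MatrixMultiplication.Theorems.LinearSolveSplitDetSolveMassThree.detSolveMassThree_holds` (its module imports this route file, so no `_holds` link can be stated here).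

/-- item stmt-MatrixMultiplication-26152 · aside · rank 9 · open · by planner
why it might fail: no det algorithm from o(n) generic solves + n^{2+o(1)} arithmetic is known: b-pivot telescoping needs ≍ n/b rounds of b size-≍n solves (mass ≍ n³) unless Schur blocks are multiplied fast, costing n·b^{ω−1} > n² arithmetic for b = n^{Ω(1)}; a new mass-saving idea is needed.
sources: BurgisserClausenShokrollahi1997, Strassen1969, BaurStrassen1983, KaltofenVillard2005
[aside] FIRST OPEN RUNG of the solve-mass ladder under B_M (gen 2; IDEA-NEEDED / INSTRUMENTABLE;
banked context, not staffed): «det from a SUB-CUBIC mass of fresh generic solves with quadratic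
side-arithmetic» — ∃ ℓ < 3 such that for every a > 2 and m₀, for large n, det(X) is derivable from
the entries of the generic X in ≤ C·n^a steps given free solutions of fresh generic systems
(presented along ℂ-algebra field maps, sizes m₀ ≤ N ≤ n) of total mass Σ N² ≤ C·n^ℓ. WEAKER than S:
necessary (kernel `subcubicSolveMass_of_summit`), implied by NO bound on ω (with SlsQuadratic it
pays only ω ≤ ℓ < 3 — not record-adjacent, answering critic C1), refutable only by refuting S.
Census test T_M (decomp-mm-census): any algebraic algorithm computing det_n / charpoly / X⁻¹ from
o(n) black-box linear solves with generic or independent right-hand sides plus O(n^{2+ε}) field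
operations? (expected none: block telescoping keeps mass ≍ n³ under quadratic arithmetic;
Wiedemann/Krylov right-hand sides are not generic; Kaltofen–Villard trades matrix products, not
solves). -/
@[route_item "route-MatrixMultiplication-LinearSolveSplit"]
def SubcubicSolveMass : Prop :=
  ∃ ℓ : ℝ, ℓ < 3 ∧ ∀ a : ℝ, 2 < a → ∀ m₀ : ℕ, ∃ C : ℝ, ∃ n₀ : ℕ, ∀ n ≥ n₀, ∃ s w : ℕ, (s : ℝ) ≤ C * (n : ℝ) ^ a ∧ (w : ℝ) ≤ C * (n : ℝ) ^ ℓ ∧ ∃ (q : ℕ) (N : ℕ → ℕ) (c : ℕ → ℕ) (φ : (i : ℕ) → i < q → (FractionRing (MvPolynomial (Fin (N i) × Fin (N i + 1)) ℂ) →ₐ[ℂ] FractionRing (MvPolynomial (Fin n × Fin n) ℂ))) (A : ℕ → Set (FractionRing (MvPolynomial (Fin n × Fin n) ℂ))), (∀ i < q, m₀ ≤ N i ∧ N i ≤ n) ∧ A 0 = Set.range (fun p : Fin n × Fin n => algebraMap (MvPolynomial (Fin n × Fin n) ℂ) (FractionRing (MvPolynomial (Fin n × Fin n) ℂ)) (MvPolynomial.X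 p)) ∧ (∀ (i : ℕ) (hi : i < q), ∃ B : Set (FractionRing (MvPolynomial (Fin n × Fin n) ℂ)), Literature.Computability.AlgebraicComplexity.Derivable ℂ (c i) (A i) B ∧ (Set.range fun p : Fin (N i) × Fin (N i + 1) => φ i hi (algebraMap (MvPolynomial (Fin (N i) × Fin (N i + 1)) ℂ) (FractionRing (MvPolynomial (Fin (N i) × Fin (N i + 1)) ℂ)) (MvPolynomial.X p))) ⊆ B ∧ A (i + 1) = A i ∪ B ∪ Set.range fun j : Fin (N i) => φ i hi (Matrix.mulVec (Matrix.of fun i' j' : Fin (N i) => algebraMap (MvPolynomial (Fin (N i) × Fin (N i + 1)) ℂ) (FractionRing (MvPolynomial (Fin (N i) × Fin (N i + 1)) ℂ)) (MvPolynomial.X (i', Fin.castSucc j')))⁻¹ (fun i' : Fin (N i) => algebraMap (MvPolynomial (Fin (N i) × Fin (N i + 1)) ℂ) (FractionRing (MvPolynomial (Fin (N i) × Fin (N i + 1)) ℂ)) (MvPolynomial.X (i', Fin.last (N i)))) j)) ∧ (∃ c' : ℕ, Literature.Computability.AlgebraicComplexity.Derivable ℂ c' (A q) {algebraMap (MvPolynomial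 (Fin n × Fin n) ℂ) (FractionRing (MvPolynomial (Fin n × Fin n) ℂ)) (Matrix.det (Matrix.of fun i j : Fin n => MvPolynomial.X (i, j)))} ∧ (∑ i ∈ Finset.range q, c i) + c' ≤ s) ∧ (∑ i ∈ Finset.range q, N i ^ 2) ≤ w

/-- item stmt-MatrixMultiplication-28411 · aside · rank 9 · closed · proved by Summit.MatrixMultiplication.MatrixMultiplication.Theorems.LinearSolveSplitSlsExponentFloor.slsExponentFloor_holds (prover) · by planner
why it might fail: none mathematically — it is the input-reading bound L(X⁻¹b | X, b) ≥ n²/2 (BCS 1997 Rem. (4.10), cf. (16.2)) in exponent form, PROVED in draft (0 sorry); the formal risks (lifting x_v ↦ x_v + 1 to the fraction field, the Cramer step, the rpow limit) are discharged.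
sources: BurgisserClausenShokrollahi1997, Strassen1969, BaurStrassen1983
[aside] w2 (gen 5; critic CLEARED 04:50:40Z «next provable-now support target»; banked context, not
staffed — PROVED in draft): «ω(SLS) ≥ 2 in the tree's model» — if an exponent τ is admissible for
ONE generic linear solve (verbatim the hypothesis clause of SlsQuadratic / DetReducesToSls at τ: for
all large n the n coordinates of X⁻¹b are `Derivable` over ℂ from the n(n+1) entries of the generic
[X | b] in ≤ C·n^τ steps of a straight-line program with division, constants free) then 2 ≤ τ.
Content for the node: the cost model of piece A is not junk (critic N3″ worry (ii) «too cheap»):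
with SlsQuadratic it pins ω(SLS) = 2 exactly at the floor, so SlsQuadratic asks for the optimal
exponent and nothing less. Finite form proved on the way: Derivable ℂ s (entries) (solution) → n² ≤
2s (input-reading bound: a length-s computation sequence reads ≤ 2s inputs, `finset_restrict`; every
ring endomorphism of ℂ(X,b) fixing the constants and the inputs read fixes everything computed,
`fixed_of_divSeq`; if 2s < n² some variable x_v is neither read nor an output, and the shift x_v ↦
x_v + 1 — an injective ℂ-algebra endomorphism of ℂ[X,b] lifted to the field by
IsFractionRing.liftAlgHom — fixes u = -/
@[route_item "route-MatrixMultiplication-LinearSolveSplit"]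
def SlsExponentFloor : Prop :=
  ∀ τ : ℝ, (∃ C : ℝ, ∃ n₀ : ℕ, ∀ n ≥ n₀, ∃ s : ℕ, (s : ℝ) ≤ C * (n : ℝ) ^ τ ∧ Literature.Computability.AlgebraicComplexity.Derivable ℂ s (Set.range fun p : Fin n × Fin (n + 1) => algebraMap (MvPolynomial (Fin n × Fin (n + 1)) ℂ) (FractionRing (MvPolynomial (Fin n × Fin (n + 1)) ℂ)) (MvPolynomial.X p)) (Set.range (Matrix.mulVec (Matrix.of fun i j : Fin n => algebraMap (MvPolynomial (Fin n × Fin (n + 1)) ℂ) (FractionRing (MvPolynomial (Fin n × Fin (n + 1)) ℂ)) (MvPolynomial.X (i, Fin.castSucc j)))⁻¹ fun i : Fin n => algebraMap (MvPolynomial (Fin n × Fin (n + 1)) ℂ) (FractionRing (MvPolynomial (Fin n × Fin (n + 1)) ℂ)) (MvPolynomial.X (i, Fin.last n))))) → 2 ≤ τ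

-- `SlsExponentFloor` holds: proved by `Summit.MatrixMultiplication.MatrixMultiplication.Theorems.LinearSolveSplitSlsExponentFloor.slsExponentFloor_holds` (its module imports this route file, so no `_holds` link can be stated here).

/-- item stmt-MatrixMultiplication-24813 · assembly · rank 1 · open · by planner
sources: BurgisserClausenShokrollahi1997, Andrews2022
[assembly] SlsQuadratic → DetReducesToSls → ω(ℂ) = 2. -/
@[route_item "route-MatrixMultiplication-LinearSolveSplit"]
def Assembly : Prop :=
  SlsQuadratic → DetReducesToSls → _root_.MatrixMultiplication

/-! D-0027 §2.1 — DECIDING THEOREM (planner-authored via `route open/edit --closes-file`; by planner-decomp-mm-lens-3-g0-0 2026-08-30T02:05:15Z):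
its hypotheses are this route's items and its conclusion the sub-problem Statement (glue_lint), and it elaborates with this file. -/

@[closes "route-MatrixMultiplication-LinearSolveSplit"] theorem closes (hA : SlsQuadratic) (hB : DetReducesToSls) : _root_.MatrixMultiplication := by
  rw [MatrixMultiplication_iff]
  refine le_antisymm (le_of_forall_gt_imp_ge_of_dense fun c hc => ?_)
    (Literature.Computability.AlgebraicComplexity.omega_two_le ℂ)
  have hτ2 : (2 : ℝ) < (2 + c) / 2 := by linarith
  have hτc : (2 + c) / 2 < c := by linarith
  have hE := Summit.MatrixMultiplication.MatrixMultiplication.Theorems.DerivationsBoundOmega.DerivationsBoundOmega_of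
  unfold Summit.MatrixMultiplication.MatrixMultiplication.Theses.CondensationDistance.DerivationsBoundOmega at hE
  exact hE c (by linarith) (hB _ hτ2.le (hA _ hτ2) c hτc)

end Summit.MatrixMultiplication.MatrixMultiplication.Theses.LinearSolveSplit
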